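import Literature.Analysis.FluidPDE.GIPKatoSmallData
import Literature.Analysis.FluidPDE.KatoContinuationProofs
import HarnessLib

/-!
# Stability of a decaying global `L³` solution (Gallagher–Iftimie–Planchon 2003, Thm. 3.1/3.2 in `L³`)

Analysis/FluidPDE proof file (theorems only, no definitions, no named facts) on the discharge
path of the named fact `Literature.Analysis.FluidPDE.GIP2003_L3_stability`
(`GIPGlobalStability.lean`; I. Gallagher, D. Iftimie, F. Planchon, *Asymptotics and stability for
global solutions to the Navier–Stokes equations*, Ann. Inst. Fourier 53 (2003) 1387–1424,
Thm. 0.1 p. 1389). Thm. 0.1 has two bullets: (i) an a priori global `C_t(L³)` solution tends to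
zero in `L³` (Thm. 2.1), and (ii) it is stable (Thm. 3.1/3.2, pp. 1398–1402: "perturbating a
global solution gives again a global solution, which moreover stays close to the given one").
This file proves **(i) ⇒ (ii)** in the tree's Kato class, at unit viscosity:

* `GIP2003.window_stability` — ONE WINDOW: if the free evolution of the slice `u(s)` is
  `≤ κ/2` in Kato's weighted norm on `(0, τ)` and `C₆‖b - u(s)‖₃ ≤ κ/2`, then `b` generates a Kato
  solution `W` on `[0, τ)` with `‖W(t) - u(s + t)‖₃ ≤ 2‖b - u(s)‖₃` (the window package of
  `GIPKatoSmallData.lean`: Kato fixed points from `u(s)` and from `b` on the common window, the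
  Lipschitz estimate of GIP Thm. 3.1 (11)/(15)–(16) on one window, and uniqueness
  `kato_unique_holds` to identify the fixed point from `u(s)` with the restarted `u`);
* `GIP2003.iterate_stability` — FINITELY MANY WINDOWS (GIP, proof of Thm. 3.1, pp. 1400–1402:
  the time decomposition `(T_i)_{1 ≤ i ≤ N}` and "a trivial induction", (15)–(16), constants
  doubling from one window to the next): along windows of length `τ` restarted every `τ/2`,
  gluing by `IsKatoSolutionOn.glue` (`mild_L3_caloric_test_holds`), one gets a Kato solution `Z`
  on `[0, kτ/2 + τ)` with `‖Z(t) - u(t)‖₃ ≤ 2^{k+1}‖b - u₀‖₃`, as long as `C₆ 2^k ‖b - u₀‖₃ ≤ κ/2`;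
* `GIP2003.stability_of_decay` — **Thm. 0.1 (ii) for a global Kato solution which decays in
  `L³`**: the uniform window length on `[0, T₀ + 1]` comes from the compactness of the orbit
  `u([0, T₀ + 1]) ⊂ L³` (`exists_uniform_small_free_evolution`), where `T₀` is a time with
  `‖u(T₀)‖₃ ≤ ε₀/2` given by the decay (GIP p. 1398/1401: "If `T = ∞` then the theorem is proved
  as a consequence of Remark A.2", i.e. the small-data theory takes over; here
  `GIP2003.small_data_global` restarted at `T₀`); the perturbed solution is global
  (`katoMaximalTime = ⊤`, `hasGlobalKatoSolution_of_katoMaximalTime_eq_top`) and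
  `‖v(t) - u(t)‖₃ ≤ 2^{N+2} ‖v₀ - u₀‖₃` for all `t ≥ 0`.

The deviation from the printed proof is only in how `[0, ∞)` is cut: GIP decompose `[0, ∞)` by
the smallness of a global space-time Besov norm of `u` ((9), (12)); here `[0, T₀]` is cut into
windows of uniform length by compactness of the `L³` orbit and `[T₀, ∞)` is one window of the
small-data theory — the `L³` route indicated in GIP, Rem. 3.1 (Kawanago's stability under decay).
Everything is proved; no statement of the tree is changed.

## References

* I. Gallagher, D. Iftimie, F. Planchon, Ann. Inst. Fourier 53 (2003) 1387–1424,
  doi:10.5802/aif.1983: Thm. 0.1 (p. 1389); §3, Thm. 3.1–3.2 and proof (pp. 1398–1402), Rem. 3.1.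
  [GallagherIftimiePlanchon2003]
* T. Kato, Math. Z. 187 (1984) 471–480, Thms. 1–2, §2. [Kato1984]
* T. Kawanago, *Stability estimate of strong solutions for the Navier–Stokes system and its
  applications*, Electron. J. Differential Equations 1998, No. 15 (the `L³` stability under
  decay, GIP ref. [12]).
-/

noncomputable section

open MeasureTheory TopologicalSpace Set Function Filter Metric
open _root_.Topology
open scoped ENNReal NNReal

namespace Literature.Analysis.FluidPDE

namespace GIP2003

/-! ### One window -/

/-- **Stability on one window** (GIP 2003, proof of Thm. 3.1, estimate (11) with (15)–(16) on a
single interval `[T_i, T_{i+1}]`; Kato 1984, §2). There are absolute `κ > 0`, `C₆ ≥ 0` such that: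
if `u` is a global Kato solution (unit viscosity), `s ≥ 0`, the free evolution of the slice
`u(s)` satisfies `t^{1/4}‖e^{tΔ}u(s)‖₆ ≤ κ/2` on `(0, τ)`, and `b ∈ L³` is weakly divergence free
with `C₆‖b - u(s)‖₃ ≤ κ/2`, then `b` generates a Kato solution `W` on `[0, τ)` with
`‖W(t) - u(t + s)‖₃ ≤ 2‖b - u(s)‖₃` for `t ∈ [0, τ)`.
[cite: GallagherIftimiePlanchon2003, Thm. 3.1 (proof, (11), (15)–(16), pp. 1400–1401)] [cite: Kato1984, §2] -/
theorem window_stability :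
    ∃ κ C₆ : ℝ, 0 < κ ∧ 0 ≤ C₆ ∧
      ∀ {u₀ : EuclideanSpace ℝ (Fin 3) → EuclideanSpace ℝ (Fin 3)} {u : ℝ → EuclideanSpace ℝ (Fin 3) → EuclideanSpace ℝ (Fin 3)}, (∀ T : ℝ, 0 < T → IsKatoSolutionOn T 1 u₀ u) →
      ∀ {s τ : ℝ}, 0 ≤ s → 0 < τ →
      (∀ t ∈ Ioo 0 τ, ENNReal.ofReal (t ^ (1 / 4 : ℝ)) *
          eLpNorm (UnboundedOperators.heatExtension (u s) t) 6 volume ≤ ENNReal.ofReal (κ / 2)) →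
      ∀ {b : EuclideanSpace ℝ (Fin 3) → EuclideanSpace ℝ (Fin 3)}, MemLp b 3 volume → IsWeaklyDivFree b →
      ENNReal.ofReal C₆ * eLpNorm (b - u s) 3 volume ≤ ENNReal.ofReal (κ / 2) →
      ∃ W : ℝ → EuclideanSpace ℝ (Fin 3) → EuclideanSpace ℝ (Fin 3), IsKatoSolutionOn τ 1 b W ∧
        ∀ t ∈ Ico 0 τ, eLpNorm (W t - u (t + s)) 3 volume ≤ 2 * eLpNorm (b - u s) 3 volume := by
  obtain ⟨κ, L₃, C₆, hκ, -, hC₆, hHEAT, hEX, hLIP⟩ := window_package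
  refine ⟨κ, C₆, hκ, hC₆, ?_⟩
  intro u₀ u hu s τ hs hτ hsmall b hb hbdiv hclose
  -- the slice `u s`
  have hK := hu (s + τ + 1) (by linarith)
  have hsI : s ∈ Ico 0 (s + τ + 1) := ⟨hs, by linarith⟩
  have ha : MemLp (u s) 3 volume := hK.memLp hsI
  have hadiv : IsWeaklyDivFree (u s) := hK.mild.1 s hsI
  have hd : MemLp (b - u s) 3 volume := hb.sub ha
  -- the free evolution of `u s` is `≤ κ` on the window
  have hsmall_a : ∀ t ∈ Ioo 0 τ, ENNReal.ofReal (t ^ (1 / 4 : ℝ)) *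
      eLpNorm (UnboundedOperators.heatExtension (u s) t) 6 volume ≤ ENNReal.ofReal κ :=
    fun t ht => (hsmall t ht).trans (ENNReal.ofReal_le_ofReal (by linarith))
  -- the free evolution of `b` is `≤ κ` on the window
  have hsmall_b : ∀ t ∈ Ioo 0 τ, ENNReal.ofReal (t ^ (1 / 4 : ℝ)) *
      eLpNorm (UnboundedOperators.heatExtension b t) 6 volume ≤ ENNReal.ofReal κ := by
    intro t ht
    have hsplit : UnboundedOperators.heatExtension b t =
        UnboundedOperators.heatExtension (u s) t +
          UnboundedOperators.heatExtension (b - u s) t := by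
      have h := heatExtension_add_eq_of_memLp ha hd (by norm_num) ht.1
      rwa [add_sub_cancel] at h
    have hm1 : AEStronglyMeasurable (UnboundedOperators.heatExtension (u s) t) volume :=
      (UnboundedOperators.memLp_heatExtension_holds ha (by norm_num) ht.1).1
    have hm2 : AEStronglyMeasurable (UnboundedOperators.heatExtension (b - u s) t) volume :=
      (UnboundedOperators.memLp_heatExtension_holds hd (by norm_num) ht.1).1
    calc ENNReal.ofReal (t ^ (1 / 4 : ℝ)) * eLpNorm (UnboundedOperators.heatExtension b t) 6 volume
        ≤ ENNReal.ofReal (t ^ (1 / 4 : ℝ)) *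
            (eLpNorm (UnboundedOperators.heatExtension (u s) t) 6 volume +
              eLpNorm (UnboundedOperators.heatExtension (b - u s) t) 6 volume) := by
          rw [hsplit]
          gcongr
          exact eLpNorm_add_le hm1 hm2 (by norm_num)
      _ = ENNReal.ofReal (t ^ (1 / 4 : ℝ)) *
              eLpNorm (UnboundedOperators.heatExtension (u s) t) 6 volume +
            ENNReal.ofReal (t ^ (1 / 4 : ℝ)) *
              eLpNorm (UnboundedOperators.heatExtension (b - u s) t) 6 volume := mul_add _ _ _
      _ ≤ ENNReal.ofReal (κ / 2) + ENNReal.ofReal C₆ * eLpNorm (b - u s) 3 volume :=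
          add_le_add (hsmall t ht) (hHEAT _ hd t ht.1)
      _ ≤ ENNReal.ofReal (κ / 2) + ENNReal.ofReal (κ / 2) := add_le_add le_rfl hclose
      _ = ENNReal.ofReal κ := by
          rw [← ENNReal.ofReal_add (by positivity) (by positivity), add_halves]
  -- Kato fixed points on `(0, τ)` from `u s` and from `b`, with their Kato-solution modifications
  obtain ⟨a', U, WU, -, hae_a, hUm, hfixU, h6U, hiU, hWU, hWUt, -⟩ :=
    hEX hκ le_rfl ha hadiv hτ hsmall_a
  obtain ⟨b', V, W, -, hae_b, hVm, hfixV, h6V, hiV, hW, hWt, -⟩ :=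
    hEX hκ le_rfl hb hbdiv hτ hsmall_b
  -- a common `L^∞` constant
  set Ba : ℝ := 2 * (κ + (4 * Real.pi * 1) ^ (-(1 / 2 : ℝ)) * (eLpNorm (u s) 3 volume).toReal)
    with hBa
  set Bb : ℝ := 2 * (κ + (4 * Real.pi * 1) ^ (-(1 / 2 : ℝ)) * (eLpNorm b 3 volume).toReal)
    with hBb
  have hBa0 : 0 ≤ Ba := by positivity
  have hiU' : ∀ t ∈ Ioo 0 τ, ∀ x, ‖U t x‖ ≤ max Ba Bb * t ^ (-(1 / 2 : ℝ)) :=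
    fun t ht x => (hiU t ht x).trans
      (mul_le_mul_of_nonneg_right (le_max_left _ _) (Real.rpow_nonneg ht.1.le _))
  have hiV' : ∀ t ∈ Ioo 0 τ, ∀ x, ‖V t x‖ ≤ max Ba Bb * t ^ (-(1 / 2 : ℝ)) :=
    fun t ht x => (hiV t ht x).trans
      (mul_le_mul_of_nonneg_right (le_max_right _ _) (Real.rpow_nonneg ht.1.le _))
  -- the Lipschitz estimate between the two fixed points
  have hlip := hLIP hκ le_rfl ha hb hae_a hae_b hUm hVm (le_max_of_le_left hBa0) hfixU hfixV
    h6U hiU' h6V hiV'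
  -- the restarted solution `u (· + s)` is the fixed point from `u s`
  have hus : IsKatoSolutionOn τ 1 (u s) (fun r => u (r + s)) := isKatoSolutionOn_translate hu hs τ
  refine ⟨W, hW, fun t ht => ?_⟩
  rcases ht.1.eq_or_lt with h0 | hpos
  · -- `t = 0`
    rw [← h0, hW.initial, zero_add, two_mul]
    exact le_self_add
  · have htI : t ∈ Ioo 0 τ := ⟨hpos, ht.2⟩
    have hUae : u (t + s) =ᵐ[volume] U t := by
      rw [← hWUt t htI]
      exact hus.ae_eq kato_unique_holds one_pos hWU hpos.le ht.2 ht.2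
    have hae : W t - u (t + s) =ᵐ[volume] -((U - V) t) := by
      rw [hWt t htI]
      filter_upwards [hUae] with x hx
      simp only [Pi.sub_apply, Pi.neg_apply, hx, neg_sub]
    calc eLpNorm (W t - u (t + s)) 3 volume = eLpNorm ((U - V) t) 3 volume := by
          rw [eLpNorm_congr_ae hae, eLpNorm_neg]
      _ ≤ 2 * eLpNorm (u s - b) 3 volume := hlip t htI
      _ = 2 * eLpNorm (b - u s) 3 volume := by rw [eLpNorm_sub_comm]

/-! ### Finitely many windows -/

/-- **Stability along finitely many windows** (GIP 2003, proof of Thm. 3.1, pp. 1400–1402: the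
time decomposition `T_1 = 0 < T_2 < ⋯` and the induction (15)–(16), constants doubling from one
window to the next). With `κ`, `C₆` as in `window_stability`: if the free evolution of every
slice `u(s)`, `s ∈ [0, S]`, is `≤ κ/2` in Kato's weighted norm on `(0, τ)`, then for every `k`
with `kτ/2 ≤ S` and every weakly divergence-free `b ∈ L³` with `C₆ 2^k ‖b - u₀‖₃ ≤ κ/2` there is a
Kato solution `Z` on `[0, kτ/2 + τ)` from `b` with `‖Z(t) - u(t)‖₃ ≤ 2^{k+1}‖b - u₀‖₃` there
(windows `[jτ/2, jτ/2 + τ)`, glued by `IsKatoSolutionOn.glue`).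
[cite: GallagherIftimiePlanchon2003, Thm. 3.1 (proof, (12)–(16), pp. 1400–1402)] -/
theorem iterate_stability :
    ∃ κ C₆ : ℝ, 0 < κ ∧ 0 ≤ C₆ ∧
      ∀ {u₀ : EuclideanSpace ℝ (Fin 3) → EuclideanSpace ℝ (Fin 3)} {u : ℝ → EuclideanSpace ℝ (Fin 3) → EuclideanSpace ℝ (Fin 3)}, (∀ T : ℝ, 0 < T → IsKatoSolutionOn T 1 u₀ u) →
      ∀ {S τ : ℝ}, 0 < τ →
      (∀ s ∈ Icc 0 S, ∀ t ∈ Ioo 0 τ, ENNReal.ofReal (t ^ (1 / 4 : ℝ)) *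
          eLpNorm (UnboundedOperators.heatExtension (u s) t) 6 volume ≤ ENNReal.ofReal (κ / 2)) →
      ∀ k : ℕ, (k : ℝ) * (τ / 2) ≤ S →
      ∀ {b : EuclideanSpace ℝ (Fin 3) → EuclideanSpace ℝ (Fin 3)}, MemLp b 3 volume → IsWeaklyDivFree b →
      ENNReal.ofReal C₆ * (2 ^ k * eLpNorm (b - u₀) 3 volume) ≤ ENNReal.ofReal (κ / 2) →
      ∃ Z : ℝ → EuclideanSpace ℝ (Fin 3) → EuclideanSpace ℝ (Fin 3), IsKatoSolutionOn ((k : ℝ) * (τ / 2) + τ) 1 b Z ∧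
        ∀ t ∈ Ico 0 ((k : ℝ) * (τ / 2) + τ),
          eLpNorm (Z t - u t) 3 volume ≤ 2 ^ (k + 1) * eLpNorm (b - u₀) 3 volume := by
  obtain ⟨κ, C₆, hκ, hC₆, hWIN⟩ := window_stability
  refine ⟨κ, C₆, hκ, hC₆, ?_⟩
  intro u₀ u hu S τ hτ hunif k
  induction k with
  | zero =>
    intro hS b hb hbdiv hclose
    have h0 : u 0 = u₀ := (hu 1 one_pos).initial
    have hS0 : (0 : ℝ) ∈ Icc 0 S := ⟨le_rfl, by simpa using hS⟩
    have hclose' : ENNReal.ofReal C₆ * eLpNorm (b - u 0) 3 volume ≤ ENNReal.ofReal (κ / 2) := by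
      simpa only [pow_zero, one_mul, h0] using hclose
    obtain ⟨W, hW, hWb⟩ := hWIN hu le_rfl hτ (hunif 0 hS0) hb hbdiv hclose'
    refine ⟨W, by simpa using hW, fun t ht => ?_⟩
    have ht' : t ∈ Ico 0 τ := by simpa using ht
    have h := hWb t ht'
    rw [add_zero, h0] at h
    simpa only [zero_add, pow_one] using h
  | succ k ih =>
    intro hS b hb hbdiv hclose
    -- the restart time
    set s : ℝ := ((k + 1 : ℕ) : ℝ) * (τ / 2) with hs_def
    have hsk : s = (k : ℝ) * (τ / 2) + τ / 2 := by
      rw [hs_def]; push_cast; ring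
    have hs0 : 0 ≤ s := by rw [hs_def]; positivity
    have hkS : (k : ℝ) * (τ / 2) ≤ S := by
      have : (k : ℝ) * (τ / 2) ≤ s := by rw [hsk]; linarith
      exact this.trans hS
    -- the previous windows
    have hmono_k : (2 : ℝ≥0∞) ^ k ≤ 2 ^ (k + 1) :=
      pow_le_pow_right₀ (by norm_num) (Nat.le_succ k)
    have hclose_k : ENNReal.ofReal C₆ * (2 ^ k * eLpNorm (b - u₀) 3 volume) ≤
        ENNReal.ofReal (κ / 2) :=
      le_trans (mul_le_mul_right (mul_le_mul_left hmono_k _) _) hclose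
    obtain ⟨Z, hZ, hZb⟩ := ih hkS hb hbdiv hclose_k
    have hsI : s ∈ Ico 0 ((k : ℝ) * (τ / 2) + τ) := ⟨hs0, by rw [hsk]; linarith⟩
    -- the new window from the slice `Z s`
    have hZs : MemLp (Z s) 3 volume := hZ.memLp hsI
    have hZsdiv : IsWeaklyDivFree (Z s) := hZ.mild.1 s hsI
    have hZsu : eLpNorm (Z s - u s) 3 volume ≤ 2 ^ (k + 1) * eLpNorm (b - u₀) 3 volume :=
      hZb s hsI
    have hclose_s : ENNReal.ofReal C₆ * eLpNorm (Z s - u s) 3 volume ≤ ENNReal.ofReal (κ / 2) :=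
      le_trans (by gcongr) hclose
    obtain ⟨W, hW, hWb⟩ := hWIN hu hs0 hτ (hunif s ⟨hs0, hS⟩) hZs hZsdiv hclose_s
    -- gluing
    have hglue := hZ.glue mild_L3_caloric_test_holds one_pos hsI hτ hW
    refine ⟨fun t => if t ≤ s then Z t else W (t - s), hglue, fun t ht => ?_⟩
    have hpow : (2 : ℝ≥0∞) ^ (k + 1) * eLpNorm (b - u₀) 3 volume ≤
        2 ^ (k + 1 + 1) * eLpNorm (b - u₀) 3 volume :=
      mul_le_mul_left (pow_le_pow_right₀ (by norm_num) (Nat.le_succ _)) _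
    by_cases hts : t ≤ s
    · -- before the restart time: the old solution
      simp only [if_pos hts]
      exact (hZb t ⟨ht.1, hts.trans_lt hsI.2⟩).trans hpow
    · -- after the restart time: the new window
      simp only [if_neg hts]
      have hts' : s < t := not_le.1 hts
      have htI : t - s ∈ Ico 0 τ := ⟨by linarith, by linarith [ht.2]⟩
      have h := hWb (t - s) htI
      rw [sub_add_cancel] at h
      calc eLpNorm (W (t - s) - u t) 3 volume ≤ 2 * eLpNorm (Z s - u s) 3 volume := h
        _ ≤ 2 * (2 ^ (k + 1) * eLpNorm (b - u₀) 3 volume) := by gcongr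
        _ = 2 ^ (k + 1 + 1) * eLpNorm (b - u₀) 3 volume := by rw [← mul_assoc, ← pow_succ']

/-! ### Stability of a decaying global Kato solution -/

/-- **GIP 2003, Thm. 0.1 (ii) / Thm. 3.1–3.2 in `L³`, for a global Kato solution which decays**
(unit viscosity). Let `u` be a global Kato solution from `u₀` (duality-form mild solution in
`C([0,∞); L³)`, `u(0) = u₀`, measurable on the strips) with `‖u(t)‖₃ → 0` as `t → ∞`
(Thm. 0.1 (i)). Then there are `ε > 0` and `C` such that every weakly divergence-free
`v₀ ∈ L³` with `‖v₀ - u₀‖₃ < ε` generates a *global* Kato solution `v`, with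
`‖v(t) - u(t)‖₃ ≤ C‖v₀ - u₀‖₃` for all `t ≥ 0`. Proof: a time `T₀` with `‖u(T₀)‖₃ ≤ ε₀/2`
(decay); a uniform window length on `[0, T₀ + 1]` (compactness of the `L³` orbit,
`exists_uniform_small_free_evolution`); `iterate_stability` up to `T₀`; then
`‖v(T₀)‖₃ ≤ ε₀` and the small-data theory from `T₀` (`small_data_global`: global existence,
`katoMaximalTime = ⊤`, and the Lipschitz bound of the restarted solutions).
[cite: GallagherIftimiePlanchon2003, Thm. 0.1 (ii) (p. 1389); Thm. 3.1–3.2 (10) and proof (pp. 1398–1402)] -/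
theorem stability_of_decay {u₀ : EuclideanSpace ℝ (Fin 3) → EuclideanSpace ℝ (Fin 3)} {u : ℝ → EuclideanSpace ℝ (Fin 3) → EuclideanSpace ℝ (Fin 3)}
    (hu : ∀ T : ℝ, 0 < T → IsKatoSolutionOn T 1 u₀ u)
    (hdecay : Tendsto (fun t => eLpNorm (u t) 3 volume) atTop (𝓝 0)) :
    ∃ ε C : ℝ, 0 < ε ∧ ∀ v₀ : EuclideanSpace ℝ (Fin 3) → EuclideanSpace ℝ (Fin 3), MemLp v₀ 3 volume → IsWeaklyDivFree v₀ →
      eLpNorm (v₀ - u₀) 3 volume < ENNReal.ofReal ε →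
      ∃ v : ℝ → EuclideanSpace ℝ (Fin 3) → EuclideanSpace ℝ (Fin 3), IsGlobalMildSolution 1 0 v₀ v ∧ ContinuousInLpOn (Ici 0) 3 v ∧
        v 0 = v₀ ∧ AEStronglyMeasurable (uncurry v) (volume.restrict (Ioi 0 ×ˢ univ)) ∧
        ∀ t : ℝ, 0 ≤ t →
          eLpNorm (v t - u t) 3 volume ≤ ENNReal.ofReal C * eLpNorm (v₀ - u₀) 3 volume := by
  obtain ⟨κ, C₆, hκ, hC₆, hITER⟩ := iterate_stability
  obtain ⟨ε₀, hε₀, hSD, hSDlip⟩ := small_data_global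
  -- a time `T₀ ≥ 0` at which `u` is small
  obtain ⟨T₀, hT₀, hsmallT₀⟩ :
      ∃ T₀ : ℝ, 0 ≤ T₀ ∧ eLpNorm (u T₀) 3 volume ≤ ENNReal.ofReal (ε₀ / 2) := by
    have h := ENNReal.tendsto_nhds_zero.1 hdecay (ENNReal.ofReal (ε₀ / 2))
      (ENNReal.ofReal_pos.2 (half_pos hε₀))
    obtain ⟨T₁, hT₁⟩ := eventually_atTop.1 h
    exact ⟨max T₁ 0, le_max_right _ _, hT₁ _ (le_max_left _ _)⟩
  -- a uniform window length on `[0, T₀ + 1]`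
  have hKc := hu (T₀ + 2) (by linarith)
  obtain ⟨τ₁, hτ₁, hunif₁⟩ := exists_uniform_small_free_evolution one_pos isCompact_Icc
    (fun s hs => ⟨hs.1, by linarith [hs.2]⟩ : Icc 0 (T₀ + 1) ⊆ Ico 0 (T₀ + 2))
    hKc.continuousInLpOn (half_pos hκ)
  set τ : ℝ := min τ₁ 1 with hτ_def
  have hτ : 0 < τ := lt_min hτ₁ one_pos
  have hτ1 : τ ≤ 1 := min_le_right _ _
  have hunif : ∀ s ∈ Icc 0 (T₀ + 1), ∀ t ∈ Ioo 0 τ, ENNReal.ofReal (t ^ (1 / 4 : ℝ)) *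
      eLpNorm (UnboundedOperators.heatExtension (u s) t) 6 volume ≤ ENNReal.ofReal (κ / 2) := by
    intro s hs t ht
    have h := hunif₁ s hs t ⟨ht.1, ht.2.trans_le (min_le_left _ _)⟩
    rwa [one_mul] at h
  -- the number of windows
  set N : ℕ := ⌈T₀ / (τ / 2)⌉₊ with hN_def
  have hNge : T₀ ≤ (N : ℝ) * (τ / 2) := by
    have h : T₀ / (τ / 2) ≤ N := Nat.le_ceil _
    rwa [div_le_iff₀ (half_pos hτ)] at h
  have hNle : (N : ℝ) * (τ / 2) ≤ T₀ + 1 := by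
    have h : (N : ℝ) < T₀ / (τ / 2) + 1 := Nat.ceil_lt_add_one (by positivity)
    have h' : (N : ℝ) * (τ / 2) < T₀ + τ / 2 := by
      have := mul_lt_mul_of_pos_right h (half_pos hτ)
      rwa [add_mul, one_mul, div_mul_cancel₀ _ (half_pos hτ).ne'] at this
    linarith
  -- the radius
  set ε : ℝ := min (κ / (2 * (C₆ + 1) * 2 ^ N)) (ε₀ / (2 * 2 ^ (N + 1))) with hε_def
  have hε : 0 < ε := lt_min (by positivity) (by positivity)
  have h2pow : ∀ n : ℕ, (2 : ℝ≥0∞) ^ n = ENNReal.ofReal ((2 : ℝ) ^ n) := fun n => by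
    rw [ENNReal.ofReal_pow zero_le_two, ENNReal.ofReal_ofNat]
  refine ⟨ε, 2 ^ (N + 2), hε, fun b hb hbdiv hlt => ?_⟩
  have hD : eLpNorm (b - u₀) 3 volume ≤ ENNReal.ofReal ε := hlt.le
  -- the two smallness conditions on the datum
  have hcloseN : ENNReal.ofReal C₆ * (2 ^ N * eLpNorm (b - u₀) 3 volume) ≤
      ENNReal.ofReal (κ / 2) := by
    calc ENNReal.ofReal C₆ * (2 ^ N * eLpNorm (b - u₀) 3 volume)
        ≤ ENNReal.ofReal C₆ * (2 ^ N * ENNReal.ofReal ε) := by gcongr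
      _ = ENNReal.ofReal (C₆ * 2 ^ N * ε) := by
          rw [h2pow, ← ENNReal.ofReal_mul (by positivity), ← ENNReal.ofReal_mul hC₆, mul_assoc]
      _ ≤ ENNReal.ofReal (κ / 2) := by
          refine ENNReal.ofReal_le_ofReal ?_
          calc C₆ * 2 ^ N * ε ≤ C₆ * 2 ^ N * (κ / (2 * (C₆ + 1) * 2 ^ N)) := by
                gcongr; exact min_le_left _ _
            _ = C₆ / (C₆ + 1) * (κ / 2) := by field_simp
            _ ≤ 1 * (κ / 2) := by
                gcongr; exact (div_le_one (by positivity)).2 (by linarith)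
            _ = κ / 2 := one_mul _
  have htailN : 2 ^ (N + 1) * eLpNorm (b - u₀) 3 volume ≤ ENNReal.ofReal (ε₀ / 2) := by
    calc 2 ^ (N + 1) * eLpNorm (b - u₀) 3 volume ≤ 2 ^ (N + 1) * ENNReal.ofReal ε := by gcongr
      _ = ENNReal.ofReal (2 ^ (N + 1) * ε) := by
          rw [h2pow, ← ENNReal.ofReal_mul (by positivity)]
      _ ≤ ENNReal.ofReal (ε₀ / 2) := by
          refine ENNReal.ofReal_le_ofReal ?_
          calc (2 : ℝ) ^ (N + 1) * ε ≤ 2 ^ (N + 1) * (ε₀ / (2 * 2 ^ (N + 1))) := by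
                gcongr; exact min_le_right _ _
            _ = ε₀ / 2 := by field_simp
  -- the solution on `[0, Nτ/2 + τ) ∋ T₀`
  obtain ⟨Z, hZ, hZb⟩ := hITER hu hτ hunif N hNle hb hbdiv hcloseN
  have hT₀I : T₀ ∈ Ico 0 ((N : ℝ) * (τ / 2) + τ) := ⟨hT₀, by linarith⟩
  have huT₀I : T₀ ∈ Ico 0 (T₀ + 2) := ⟨hT₀, by linarith⟩
  have huT₀mem : MemLp (u T₀) 3 volume := hKc.memLp huT₀I
  have huT₀div : IsWeaklyDivFree (u T₀) := hKc.mild.1 T₀ huT₀I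
  have hZT₀mem : MemLp (Z T₀) 3 volume := hZ.memLp hT₀I
  have hZT₀div : IsWeaklyDivFree (Z T₀) := hZ.mild.1 T₀ hT₀I
  -- smallness of `Z T₀`
  have hZT₀ : eLpNorm (Z T₀) 3 volume ≤ ENNReal.ofReal ε₀ := by
    calc eLpNorm (Z T₀) 3 volume = eLpNorm ((Z T₀ - u T₀) + u T₀) 3 volume := by
          rw [sub_add_cancel]
      _ ≤ eLpNorm (Z T₀ - u T₀) 3 volume + eLpNorm (u T₀) 3 volume :=
          eLpNorm_add_le (hZT₀mem.sub huT₀mem).1 huT₀mem.1 (by norm_num)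
      _ ≤ 2 ^ (N + 1) * eLpNorm (b - u₀) 3 volume + ENNReal.ofReal (ε₀ / 2) :=
          add_le_add (hZb T₀ hT₀I) hsmallT₀
      _ ≤ ENNReal.ofReal (ε₀ / 2) + ENNReal.ofReal (ε₀ / 2) := add_le_add htailN le_rfl
      _ = ENNReal.ofReal ε₀ := by
          rw [← ENNReal.ofReal_add (by positivity) (by positivity), add_halves]
  -- the small-data theory from `T₀`: `T_max(b) = ∞`
  have hG : HasGlobalKatoSolution 1 (Z T₀) := hSD (Z T₀) hZT₀mem hZT₀div hZT₀
  have htop : katoMaximalTime 1 b = ⊤ := by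
    refine ENNReal.eq_top_of_forall_nnreal_le fun r => ?_
    obtain ⟨G, hGr⟩ := hG.exists_isKatoSolutionOn ((r : ℝ) + 1)
    have hglue := hZ.glue mild_L3_caloric_test_holds one_pos hT₀I (by positivity) hGr
    calc (r : ℝ≥0∞) = ENNReal.ofReal (r : ℝ) := ENNReal.ofReal_coe_nnreal.symm
      _ ≤ ENNReal.ofReal (T₀ + ((r : ℝ) + 1)) := ENNReal.ofReal_le_ofReal (by linarith)
      _ ≤ katoMaximalTime 1 b := hglue.ofReal_le_katoMaximalTime
  obtain ⟨v, hvmild, hvcont, hv0, hvmeas⟩ :=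
    hasGlobalKatoSolution_of_katoMaximalTime_eq_top kato_unique_holds one_pos htop
  have hv : ∀ T : ℝ, 0 < T → IsKatoSolutionOn T 1 b v := fun T _ =>
    isKatoSolutionOn_of_global hvmild hvcont hv0 hvmeas T
  refine ⟨v, hvmild, hvcont, hv0, hvmeas, fun t ht => ?_⟩
  rw [← h2pow]
  -- the head `[0, Nτ/2 + τ)`: `v = Z` a.e.
  have hhead : ∀ r ∈ Ico 0 ((N : ℝ) * (τ / 2) + τ),
      eLpNorm (v r - u r) 3 volume ≤ 2 ^ (N + 1) * eLpNorm (b - u₀) 3 volume := by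
    intro r hr
    have hae : v r =ᵐ[volume] Z r :=
      (hv (r + 1) (by linarith [hr.1])).ae_eq kato_unique_holds one_pos hZ hr.1 (by linarith) hr.2
    rw [eLpNorm_congr_ae (hae.sub EventuallyEq.rfl)]
    exact hZb r hr
  have hpow : (2 : ℝ≥0∞) ^ (N + 1) * eLpNorm (b - u₀) 3 volume ≤
      2 ^ (N + 2) * eLpNorm (b - u₀) 3 volume :=
    mul_le_mul_left (pow_le_pow_right₀ (by norm_num) (Nat.le_succ _)) _
  rcases lt_or_ge t ((N : ℝ) * (τ / 2) + τ) with hlt' | hge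
  · exact (hhead t ⟨ht, hlt'⟩).trans hpow
  · -- the tail `[T₀, ∞)`: restart both solutions at `T₀` and use the small-data Lipschitz bound
    have hT₀t : T₀ ≤ t := by linarith
    have hvT₀I : T₀ ∈ Ico 0 (T₀ + 1) := ⟨hT₀, by linarith⟩
    have hvT₀mem : MemLp (v T₀) 3 volume := (hv (T₀ + 1) (by linarith)).memLp hvT₀I
    have hvT₀div : IsWeaklyDivFree (v T₀) := (hv (T₀ + 1) (by linarith)).mild.1 T₀ hvT₀I
    have hvZ : v T₀ =ᵐ[volume] Z T₀ :=
      (hv (T₀ + 1) (by linarith)).ae_eq kato_unique_holds one_pos hZ hT₀ (by linarith) hT₀I.2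
    have hvT₀ : eLpNorm (v T₀) 3 volume ≤ ENNReal.ofReal ε₀ := by
      rw [eLpNorm_congr_ae hvZ]; exact hZT₀
    have huT₀ : eLpNorm (u T₀) 3 volume ≤ ENNReal.ofReal ε₀ :=
      hsmallT₀.trans (ENNReal.ofReal_le_ofReal (by linarith))
    have h := hSDlip (v T₀) (u T₀) (fun r => v (r + T₀)) (fun r => u (r + T₀)) hvT₀mem hvT₀div
      hvT₀ huT₀mem huT₀div huT₀ (fun T _ => isKatoSolutionOn_translate hv hT₀ T)
      (fun T _ => isKatoSolutionOn_translate hu hT₀ T) (t - T₀) (by linarith)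
    simp only [sub_add_cancel] at h
    calc eLpNorm (v t - u t) 3 volume ≤ 2 * eLpNorm (v T₀ - u T₀) 3 volume := h
      _ ≤ 2 * (2 ^ (N + 1) * eLpNorm (b - u₀) 3 volume) := by gcongr; exact hhead T₀ hT₀I
      _ = 2 ^ (N + 2) * eLpNorm (b - u₀) 3 volume := by rw [← mul_assoc, ← pow_succ']

end GIP2003

end Literature.Analysis.FluidPDE

end
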